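import Literature.AlgebraicGeometry.Frobenioids.ArchimedeanFSM
import Literature.AlgebraicGeometry.Frobenioids.ArchimedeanRegionCalculus
import HarnessLib

/-!
# Frobenioids II, Proposition 3.4 (vi): PROOF of the lifting of factorizations
# (abc-iut cell, layer L1, node `FrdII:Prop3.4(vi)`, chain LC-L1-2)

Mochizuki, *The geometry of Frobenioids II: poly-Frobenioids*, Kyushu J. Math. **62** (2008)
401–460, §3, Proposition 3.4 (vi) p. 30, proof p. 31 [cite: MochizukiFrdII2008, Prop 3.4 (vi) p.30].
PROOF-ONLY companion of `ArchimedeanFSM.lean` (statements, seat abc-iut-L1-t6).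

> "(vi) If `φ` is a morphism of `F` such that `φ_D := Base(φ)` admits a factorization
> `φ_D = α_D ∘ β_D` in `D`, then there exist morphisms `α`, `β` of `F` lifting `α_D`, `β_D`,
> respectively, such that `φ = α ∘ β` in `F`. In particular, irreducible morphisms of `F` project to
> either isomorphisms or irreducible morphisms of `D`; FSMI-morphisms [cf. (iii)] of `F` project to
> either isomorphisms or FSMI-morphisms of `D`."

What is PROVED here, for `F = A, N, R` (`towerA`, `towerN`, `towerR`):
* the main clause `Tower.PropVI` — `A.propVI`, `N.propVI`, `R.propVI`, assembled in `prop34_vi_main`.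
  The lift is explicit (Def. 3.1 (iv) base change): `α := (α_D, 1, 1)` out of the object over the
  middle base carrying the pulled-back angular region `A_K|`, and `β := (β_D, deg_Fr φ, c_φ)`, whose
  condition (c) is that of `φ` by the transitivity of base change (`C0.pullRegion_comp`); `β` has the
  divisor of `φ` (same tip), `α` is a linear isometry (`C0.exists_factor`, `C.exists_factor`);
* the first "in particular" `Tower.PropVI_irreducible` — for ANY tower it follows from `PropVI`
  (`Tower.propVI_irreducible_of_propVI`), assembled in `prop34_vi_irreducible`;
* the second "in particular" `Tower.PropVI_FSMI` follows from `PropVI` AND item (iii) ("[cf. (iii)]"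
  in the text): `Tower.propVI_FSMI_of_propVI_of_propIII`; hence the cell's bundled node statement
  `Prop34_vi π` is proved FROM `Prop34_iii π` (`prop34_vi_of_prop34_iii`). Item (iii) itself rests on
  item (ii) and Lemma 3.2 (ix) (text p. 31) and is NOT proved in this file; its printed reduction to
  (i), (ii) and the Lemma 3.2 (ix) observation is `Tower.propIII_of_propI_of_propII`.
Nothing is defined here; no statement of the paper is strengthened; no side is taken on
[IUTchIII] Cor. 3.12.
-/

namespace Literature.AlgebraicGeometry.Frobenioids

open CategoryTheory
open scoped Pointwise

namespace ArchFrd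

universe v u

/-! ### Generic consequences for a tower -/

namespace Tower

variable {D : Type u} [Category.{v} D] {π : D ⥤ D0} (T : Tower π)

/-- **Prop. 3.4 (vi), "In particular"** (first half), for any tower: if factorizations of `Base(φ)`
lift (`PropVI`), then "irreducible morphisms of `F` project to either isomorphisms or irreducible
morphisms of `D`". [cite: MochizukiFrdII2008, Prop 3.4 (vi) p.30] -/
theorem propVI_irreducible_of_propVI (h : T.PropVI) : T.PropVI_irreducible := by
  intro X Y φ hφ
  by_cases hiso : IsIso (T.toD.map φ)
  · exact Or.inl hiso
  refine Or.inr ⟨hiso, fun E βD αD hfac => ?_⟩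
  obtain ⟨E', β, α, i, hcomp, hβ, hα⟩ := h φ E βD αD hfac
  rcases hφ.2 β α hcomp with hα' | hβ'
  · left
    rw [← hα]
    haveI := hα'
    infer_instance
  · right
    rw [← hβ]
    haveI := hβ'
    infer_instance

/-- **Prop. 3.4 (vi), "In particular"** (second half), for any tower: from `PropVI` and item (iii)
("FSMI-morphisms [cf. (iii)]"), "FSMI-morphisms of `F` project to either isomorphisms or
FSMI-morphisms of `D`". [cite: MochizukiFrdII2008, Prop 3.4 (vi) p.30] -/
theorem propVI_FSMI_of_propVI_of_propIII (h6 : T.PropVI) (h3 : T.PropIII) : T.PropVI_FSMI := by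
  intro X Y φ hφ
  rcases T.propVI_irreducible_of_propVI h6 φ hφ.2 with hiso | hirr
  · exact Or.inl hiso
  · exact Or.inr ⟨h3 φ hφ.1, hirr⟩

/-- **Prop. 3.4 (iii), the printed reduction** (proof p. 31: "Assertion (iii) follows immediately from
assertions (i), (ii), together with the observation that if `φ` is a fiberwise-surjective morphism of
`F` that does not satisfy condition (a) of assertion (ii), then [cf. Lemma 3.2, (ix)] `φ` necessarily
satisfies condition (b)"), for any tower: (i), (ii) and that observation give (iii).
[cite: MochizukiFrdII2008, Prop 3.4 (iii) p.31] -/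
theorem propIII_of_propI_of_propII (h1 : T.PropI) (h2 : T.PropII)
    (hobs : ∀ ⦃X Y : T.F⦄ (φ : X ⟶ Y), IsFiberwiseSurjective φ → ¬ T.CondA φ → T.CondB φ) :
    T.PropIII := by
  intro X Y φ hφ
  refine ⟨h1 φ hφ.1, ?_⟩
  haveI := hφ.2
  refine h2 φ hφ.2 ?_
  by_cases ha : T.CondA φ
  · exact Or.inl ha
  · exact Or.inr (hobs φ hφ.1 ha)

end Tower

/-! ### Factorizations at the level of `C₀` -/

namespace C0

/-- Two arrows of `C₀` with the same domain, Frobenius degree and scalar, into objects with the same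
tip, have the same divisor (`Div(φ) = log (tip_K / (|c| tip_L^d))`, Ex. 3.3 (i)).
[cite: MochizukiFrdII2008, Ex 3.3 (i) p.28] -/
theorem div_eq_of_tip_eq {X Y Y' : C0} (φ : X ⟶ Y) (ψ : X ⟶ Y') (hd : degFr ψ = degFr φ)
    (hs : scalar ψ = scalar φ) (ht : Y'.tip = Y.tip) : div ψ = div φ := by
  have hr : ratio ψ = ratio φ := by
    unfold ratio
    rw [hd, hs, ht]
  unfold div
  simp only [hr]

/-- **Prop. 3.4 (vi), proof, at the level of `C₀`**: a factorization `Base(φ) = α_b ∘ β_b` in `D₀` of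
the base of `φ : X → Y` lifts to `φ = α ∘ β` in `C₀` through the object over the middle base carrying
the pulled-back region `A_K|` (Def. 3.1 (iv)): `α = (α_b, 1, 1)` is a linear isometry and
`β = (β_b, deg_Fr φ, c_φ)` has the Frobenius degree, scalar and divisor of `φ`.
[cite: MochizukiFrdII2008, Prop 3.4 (vi) p.30] -/
theorem exists_factor {X Y : C0} (φ : X ⟶ Y) {L : D0} (βb : X.base ⟶ L) (αb : L ⟶ Y.base)
    (h : βb ≫ αb = Base φ) :
    ∃ (A : AngularRegion ℂ) (hA : L = D0.real → A.IsIsotropic)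
      (β : X ⟶ C0.mk L A hA) (α : C0.mk L A hA ⟶ Y),
      β ≫ α = φ ∧ Base β = βb ∧ Base α = αb ∧ degFr β = degFr φ ∧ scalar β = scalar φ ∧
        div β = div φ ∧ degFr α = 1 ∧ scalar α = 1 ∧ PreFrobenioid.IsIsometry toElem α := by
  obtain ⟨A, hcar, htip, -, hiso⟩ := exists_pulledRegion Y αb
  have hYb : L = D0.real → Y.base = D0.real := by
    rintro rfl
    obtain ⟨K, R, hR⟩ := Y
    cases K with
    | real => rfl
    | complex => exact (D0.isEmpty_hom_real_complex.false αb).elim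
  have hA : L = D0.real → A.IsIsotropic := fun hL => hiso (Y.isIsotropic_of_isReal (hYb hL))
  have hmβ : scalar φ • X.region.carrier ^ (degFr φ : ℕ) ⊆ pullRegion (C0.mk L A hA) βb := by
    show scalar φ • X.region.carrier ^ (degFr φ : ℕ) ⊆ βb.act '' A.carrier
    rw [hcar, ← pullRegion_comp, h]
    exact φ.mapsTo
  have hmα : (1 : ℂˣ) • (C0.mk L A hA).region.carrier ^ ((1 : ℕ+) : ℕ) ⊆ pullRegion Y αb := by
    rw [one_smul, PNat.one_coe, pow_one]
    exact hcar.le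
  have htip' : (C0.mk L A hA).tip = Y.tip := by
    show (A.tip : ℝ) = (Y.region.tip : ℝ)
    rw [htip]
  refine ⟨A, hA, ⟨βb, degFr φ, scalar φ, φ.scalar_mem, hmβ⟩, ⟨αb, 1, 1, one_mem _, hmα⟩, ?_, rfl,
    rfl, rfl, rfl, div_eq_of_tip_eq φ _ rfl rfl htip', rfl, rfl, ?_⟩
  · refine C0.hom_ext h (mul_one _) ?_
    show βb.act 1 * scalar φ ^ ((1 : ℕ+) : ℕ) = scalar φ
    rw [map_one, PNat.one_coe, pow_one, one_mul]
  · rw [A0.isIsometry_iff_norm_mul_tip_pow]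
    show ‖((1 : ℂˣ) : ℂ)‖ * (C0.mk L A hA).tip ^ ((1 : ℕ+) : ℕ) = Y.tip
    rw [Units.val_one, norm_one, one_mul, PNat.one_coe, pow_one]
    exact htip'

end C0

/-! ### Factorizations in `C = C₀ ×_{D₀} D` and Prop. 3.4 (vi) for `A`, `N`, `R` -/

variable {D : Type u} [Category.{v} D] (π : D ⥤ D0)

/-- **Prop. 3.4 (vi), proof, in `C = C₀ ×_{D₀} D`**: a factorization `φ_D = α_D ∘ β_D` in `D` of the
projection of an arrow `φ` of `C` lifts to `φ = α ∘ β` in `C`, with `α` a linear isometry of `C₀` in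
the first component and `β` carrying the Frobenius degree and divisor of `φ` there; the middle object
projects to the middle object of `D` on the nose. [cite: MochizukiFrdII2008, Prop 3.4 (vi) p.30] -/
theorem C.exists_factor {X Y : C π} (f : X ⟶ Y) (E : D) (βD : X.snd ⟶ E) (αD : E ⟶ Y.snd)
    (h : βD ≫ αD = f.snd) :
    ∃ (E' : C π) (β : X ⟶ E') (α : E' ⟶ Y) (i : E'.snd ≅ E),
      β ≫ α = f ∧ β.snd ≫ i.hom = βD ∧ i.inv ≫ α.snd = αD ∧
        C0.degFr β.fst = C0.degFr f.fst ∧ C0.div β.fst = C0.div f.fst ∧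
        C0.degFr α.fst = 1 ∧ C0.div α.fst = 1 := by
  obtain ⟨X0, XD, ιX⟩ := X
  obtain ⟨Y0, YD, ιY⟩ := Y
  obtain ⟨f0, fD, w⟩ := f
  change XD ⟶ E at βD
  change E ⟶ YD at αD
  change βD ≫ αD = fD at h
  have w'' : (PreFrobenioid.baseFunctor C0.toElem).map f0 = (ιX.hom ≫ π.map fD) ≫ ιY.inv :=
    (Iso.eq_comp_inv ιY).mpr w
  have hb : (ιX.hom ≫ π.map βD) ≫ (π.map αD ≫ ιY.inv) = C0.Base f0 :=
    calc (ιX.hom ≫ π.map βD) ≫ (π.map αD ≫ ιY.inv)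
        = (ιX.hom ≫ π.map (βD ≫ αD)) ≫ ιY.inv := by simp only [Functor.map_comp, Category.assoc]
      _ = (ιX.hom ≫ π.map fD) ≫ ιY.inv := by rw [h]
      _ = (PreFrobenioid.baseFunctor C0.toElem).map f0 := w''.symm
  obtain ⟨A, hA, β0, α0, hcomp, hbβ, hbα, hdβ, -, hdivβ, hdα, -, hisoα⟩ :=
    C0.exists_factor f0 (ιX.hom ≫ π.map βD) (π.map αD ≫ ιY.inv) hb
  let E0 : C0 := ⟨π.obj E, A, hA⟩
  let E' : C π := ⟨E0, E, Iso.refl _⟩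
  have hbβ' : (PreFrobenioid.baseFunctor C0.toElem).map β0 = ιX.hom ≫ π.map βD := hbβ
  have hbα' : (PreFrobenioid.baseFunctor C0.toElem).map α0 = π.map αD ≫ ιY.inv := hbα
  have wβ : (PreFrobenioid.baseFunctor C0.toElem).map β0 ≫ E'.iso.hom = ιX.hom ≫ π.map βD :=
    (Category.comp_id _).trans hbβ'
  have wα : (PreFrobenioid.baseFunctor C0.toElem).map α0 ≫ ιY.hom = E'.iso.hom ≫ π.map αD :=
    ((Iso.eq_comp_inv ιY).mp hbα').trans (Category.id_comp _).symm
  exact ⟨E', ⟨β0, βD, wβ⟩, ⟨α0, αD, wα⟩, Iso.refl E, CFP.hom_ext hcomp h, Category.comp_id _,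
    Category.id_comp _, hdβ, hdivβ, hdα, hisoα⟩

/-- **Proposition 3.4 (vi)**, main clause, for `F = A` (the angular Frobenioid): factorizations of
`Base(φ)` in `D` lift to factorizations of `φ` in `A` (the lift `β` has the divisor of `φ`, so it is an
isometry; `α` is an isometry). [cite: MochizukiFrdII2008, Prop 3.4 (vi) p.30] -/
theorem A.propVI : (towerA π).PropVI := by
  intro X Y φ E βD αD hfac
  obtain ⟨E', β, α, i, hcomp, hβ, hα, -, hdivβ, -, hdivα⟩ :=
    C.exists_factor π φ.hom E βD αD hfac
  have hdivβ' : PreFrobenioid.Div C0.toElem β.fst = PreFrobenioid.Div C0.toElem φ.hom.fst := hdivβ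
  have hdivα' : PreFrobenioid.Div C0.toElem α.fst = 1 := hdivα
  have hβA : PreFrobenioid.isometricMorphisms (C.toElem π) β := by
    change pull _ _ (PreFrobenioid.Div C0.toElem β.fst) = 1
    rw [hdivβ']
    exact φ.property
  have hαA : PreFrobenioid.isometricMorphisms (C.toElem π) α := by
    change pull _ _ (PreFrobenioid.Div C0.toElem α.fst) = 1
    rw [hdivα', map_one]
  exact ⟨⟨E'⟩, ⟨β, hβA⟩, ⟨α, hαA⟩, i, WideSubcategory.hom_ext _ hcomp, hβ, hα⟩

/-- **Proposition 3.4 (vi)**, main clause, for `F = N` (the non-rigidified angloid): as for `A`, the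
lifts being moreover linear (`β` has the Frobenius degree of `φ`, `α` has degree `1`).
[cite: MochizukiFrdII2008, Prop 3.4 (vi) p.30] -/
theorem N.propVI : (towerN π).PropVI := by
  intro X Y φ E βD αD hfac
  obtain ⟨E', β, α, i, hcomp, hβ, hα, hdegβ, hdivβ, hdegα, hdivα⟩ :=
    C.exists_factor π φ.hom.hom E βD αD hfac
  have hdivβ' : PreFrobenioid.Div C0.toElem β.fst = PreFrobenioid.Div C0.toElem φ.hom.hom.fst :=
    hdivβ
  have hdivα' : PreFrobenioid.Div C0.toElem α.fst = 1 := hdivα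
  have hβA : PreFrobenioid.isometricMorphisms (C.toElem π) β := by
    change pull _ _ (PreFrobenioid.Div C0.toElem β.fst) = 1
    rw [hdivβ']
    exact φ.hom.property
  have hαA : PreFrobenioid.isometricMorphisms (C.toElem π) α := by
    change pull _ _ (PreFrobenioid.Div C0.toElem α.fst) = 1
    rw [hdivα', map_one]
  have hβN : PreFrobenioid.linearMorphisms (A.toElem π) (⟨β, hβA⟩ : X.obj ⟶ (⟨E'⟩ : A π)) := by
    change C0.degFr β.fst = 1
    rw [hdegβ]
    exact φ.property
  have hαN : PreFrobenioid.linearMorphisms (A.toElem π) (⟨α, hαA⟩ : (⟨E'⟩ : A π) ⟶ Y.obj) := hdegα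
  exact ⟨⟨⟨E'⟩⟩, ⟨⟨β, hβA⟩, hβN⟩, ⟨⟨α, hαA⟩, hαN⟩, i,
    WideSubcategory.hom_ext _ (WideSubcategory.hom_ext _ hcomp), hβ, hα⟩

/-- **Proposition 3.4 (vi)**, main clause, for `F = R` (the rigidified angloid `R₀ ×_{D₀} D`): the
linear isometric lifts in `N₀`, read over the real unit through the structure arrow of the codomain,
give the factorization in `R`. [cite: MochizukiFrdII2008, Prop 3.4 (vi) p.30] -/
theorem R.propVI : (towerR π).PropVI := by
  intro X Y φ E βD αD hfac
  obtain ⟨rX, XD, ιX⟩ := X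
  obtain ⟨rY, YD, ιY⟩ := Y
  obtain ⟨g, fD, w⟩ := φ
  change XD ⟶ E at βD
  change E ⟶ YD at αD
  change βD ≫ αD = fD at hfac
  have w'' : R0.toD0.map g = (ιX.hom ≫ π.map fD) ≫ ιY.inv := (Iso.eq_comp_inv ιY).mpr w
  have hb : (ιX.hom ≫ π.map βD) ≫ (π.map αD ≫ ιY.inv) = C0.Base g.left.hom.hom :=
    calc (ιX.hom ≫ π.map βD) ≫ (π.map αD ≫ ιY.inv)
        = (ιX.hom ≫ π.map (βD ≫ αD)) ≫ ιY.inv := by simp only [Functor.map_comp, Category.assoc]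
      _ = (ιX.hom ≫ π.map fD) ≫ ιY.inv := by rw [hfac]
      _ = R0.toD0.map g := w''.symm
  obtain ⟨A, hA, β0, α0, hcomp, hbβ, hbα, hdβ, -, hdivβ, hdα, -, hisoα⟩ :=
    C0.exists_factor g.left.hom.hom (ιX.hom ≫ π.map βD) (π.map αD ≫ ιY.inv) hb
  let E0 : C0 := ⟨π.obj E, A, hA⟩
  let nE : N0 := ⟨⟨E0⟩⟩
  have hisoβ : PreFrobenioid.IsIsometry C0.toElem β0 := by
    change C0.div β0 = 1
    rw [hdivβ]
    exact g.left.hom.property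
  have hlinβ : C0.degFr β0 = 1 := hdβ.trans (show C0.degFr g.left.hom.hom = 1 from g.left.property)
  let gβ : rX.left ⟶ nE := N0.homMk β0 hisoβ hlinβ
  let gα : nE ⟶ rY.left := N0.homMk α0 hisoα hdα
  have hβα : gβ ≫ gα = g.left := N0.hom_ext hcomp
  let rE : R0 := Over.mk (gα ≫ rY.hom)
  let αO : rE ⟶ rY := Over.homMk gα rfl
  have hwβ : gβ ≫ rE.hom = rX.hom := by
    show gβ ≫ (gα ≫ rY.hom) = rX.hom
    rw [← Category.assoc, hβα]
    exact Over.w g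
  let βO : rX ⟶ rE := Over.homMk gβ hwβ
  let E' : R π := ⟨rE, E, Iso.refl _⟩
  have hbβ' : R0.toD0.map βO = ιX.hom ≫ π.map βD := hbβ
  have hbα' : R0.toD0.map αO = π.map αD ≫ ιY.inv := hbα
  have wβ : R0.toD0.map βO ≫ E'.iso.hom = ιX.hom ≫ π.map βD := (Category.comp_id _).trans hbβ'
  have wα : R0.toD0.map αO ≫ ιY.hom = E'.iso.hom ≫ π.map αD :=
    ((Iso.eq_comp_inv ιY).mp hbα').trans (Category.id_comp _).symm
  exact ⟨E', ⟨βO, βD, wβ⟩, ⟨αO, αD, wα⟩, Iso.refl E, CFP.hom_ext (Over.OverMorphism.ext hβα) hfac,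
    Category.comp_id _, Category.id_comp _⟩

/-- **Proposition 3.4 (vi)**, main clause, PROVED for `F = A, N, R`: "If `φ` is a morphism of `F` such
that `φ_D := Base(φ)` admits a factorization `φ_D = α_D ∘ β_D` in `D`, then there exist morphisms
`α`, `β` of `F` lifting `α_D`, `β_D`, respectively, such that `φ = α ∘ β` in `F`."
[cite: MochizukiFrdII2008, Prop 3.4 (vi) p.30] -/
theorem prop34_vi_main : (towerA π).PropVI ∧ (towerN π).PropVI ∧ (towerR π).PropVI :=
  ⟨A.propVI π, N.propVI π, R.propVI π⟩

/-- **Proposition 3.4 (vi)**, "In particular, irreducible morphisms of `F` project to either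
isomorphisms or irreducible morphisms of `D`", PROVED for `F = A, N, R`.
[cite: MochizukiFrdII2008, Prop 3.4 (vi) p.30] -/
theorem prop34_vi_irreducible :
    (towerA π).PropVI_irreducible ∧ (towerN π).PropVI_irreducible ∧ (towerR π).PropVI_irreducible :=
  ⟨(towerA π).propVI_irreducible_of_propVI (A.propVI π),
    (towerN π).propVI_irreducible_of_propVI (N.propVI π),
    (towerR π).propVI_irreducible_of_propVI (R.propVI π)⟩

/-- **Proposition 3.4 (vi)** as bundled by the cell (`Prop34_vi`: main clause + both "in particular"
clauses for `A`, `N`, `R`), PROVED FROM item (iii) (`Prop34_iii`), which the FSMI clause cites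
("[cf. (iii)]"); the main and irreducible clauses are unconditional (`prop34_vi_main`,
`prop34_vi_irreducible`). [cite: MochizukiFrdII2008, Prop 3.4 (vi) p.30] -/
theorem prop34_vi_of_prop34_iii (h3 : Prop34_iii π) : Prop34_vi π :=
  ⟨⟨A.propVI π, (towerA π).propVI_irreducible_of_propVI (A.propVI π),
      (towerA π).propVI_FSMI_of_propVI_of_propIII (A.propVI π) h3.1⟩,
    ⟨N.propVI π, (towerN π).propVI_irreducible_of_propVI (N.propVI π),
      (towerN π).propVI_FSMI_of_propVI_of_propIII (N.propVI π) h3.2.1⟩,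
    ⟨R.propVI π, (towerR π).propVI_irreducible_of_propVI (R.propVI π),
      (towerR π).propVI_FSMI_of_propVI_of_propIII (R.propVI π) h3.2.2⟩⟩

end ArchFrd

end Literature.AlgebraicGeometry.Frobenioids
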